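import Summits.ValiantsHypothesis.ValiantsHypothesis.Theses.BarrierLever
import Summits.ValiantsHypothesis.ValiantsHypothesis.Theorems.BarrierLeverSuccinctHittingSetsForVPWinWin
import Summits.ValiantsHypothesis.ValiantsHypothesis.Theorems.BarrierLeverSuccinctHittingSetsForVPADDoor
import Summits.ValiantsHypothesis.ValiantsHypothesis.Theorems.BarrierLeverSuccinctHittingSetsForVPKRSTDoor
import Summits.ValiantsHypothesis.ValiantsHypothesis.Theorems.BarrierLeverReadOnceDeterminantsHitByVPOfCrux
import Summits.ValiantsHypothesis.ValiantsHypothesis.Theorems.BarrierLeverTorusIsolatedDeterminantsHitByVPReductions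
import Literature.Barriers.ValiantsHypothesis.AlgebraicNaturalProofsGenerators
import Literature.Barriers.ValiantsHypothesis.AlgebraicNaturalProofsKRSTVNP

/-!
# Route BarrierLever — the «what would suffice» chain from the natural-proofs corpus to the V4 rung
# decls (cell val-lit, NP corpus lead; sources FSV18, GKSS17, CKRST20, KRST22, EGOW18, BIJL18, AF22)

Every theorem below is sorry-free GLUE: its hypotheses are the OPEN links (spelled out, or existing
open items / open Literature hypotheses BY NAME), its conclusion is one of the route's rung decls
BY NAME — `Theses.BarrierLever.SuccinctHittingSetsForVP` (crux, stmt-ValiantsHypothesis-14610 =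
FSV Question 6 over `ℂ`), `Theses.BarrierLever.KRSTForVP` (stmt-18967 = KRST22 open problem 1),
`Theses.BarrierLever.NaturalProofsSeparateVNP` (stmt-18972 = the CKRST20-type conclusion with the
coefficient restriction dropped), `Theses.BarrierLever.ReadOnceDeterminantsHitByVP` (stmt-20152 =
FSV §8) and `Theses.BarrierLever.ChowHitsReadOnceDeterminants` (stmt-20239). Nothing here is new
mathematics: each arrow CITES a door already in the tree. No `def`s (open hypotheses are items, not
facts; D-0059). Does NOT close any item.

The chain, source by source (N-labels = the cell's GAP-LEDGER rows):
* N1 FSV18 (Def. 7, Lemmas 13–14, Cor. 15, Question 6): `crux_of_succinctGeneratorsForVP` —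
  succinct hitting-set GENERATORS for `VP` (`Literature…SuccinctGeneratorsForVP ℂ`, open) ⇒ crux.
* N2 GKSS17 (Open Question 1, `VP_ws` half) / FSV §1.3 (Aaronson–Drucker-type door):
  `crux_of_succinctHittingSetsForVBP` — item 18966 (VBP-succinct hitting sets) ⇒ crux.
* N3 CKRST20 / KRST22 §1.2 (the VP-version of "equations for the {−1,0,1}-slice"):
  `naturalProofsSeparateVNP_of_not_crux` — under exponential hardness of the permanent, if the crux
  FAILS then item 18972 holds (KRST's win–win; the disjunction itself is the tree's `WinWin.win_win`);
  `not_crux_of_naturalProofsSeparateVNP` — item 18972 refutes the crux unconditionally.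
* N4 KRST22 (open problem 1): `krstForVP_of_crux` (trivial), `krstForVP_of_jointlySuccinctGenerator`
  — the failing arrow ★★ (a JOINTLY `VP`-succinct generator fooling level one, from per-hardness)
  is exactly what item 18967 needs (`WinWin.generator_iff_krstForVP`), and
  `crux_of_permanentExpHard_of_krstSuccinctInVP` — the KRST door with its unproven succinctness
  hypothesis displayed (satisfiable over `ℂ` only in the residual band, items 19049/19050; the bands
  `b < 6c` and, under [B05], `b < 12c` are closed no-go: `KRSTNoGoBelow6c_holds`,
  `KRSTNoGoBelow12cOnB05_holds`).
* N5 EGOW18 / N7 AF22 (rank-method distinguishers = read-once coefficient determinants; FSV §8):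
  `readOnceDeterminantsHitByVP_of_crux'` — crux ⇒ item 20152; `readOnceDeterminantsHitByVP_of_balanced`
  and `chowHitsReadOnceDeterminants_of_balanced` — for items 20152 / 20239 only the torus-BALANCED
  layouts remain (the torus-isolated ones are PROVED hit: `TorusIsolatedDeterminantsHitByVP_holds`).
* N6 BIJL18 (Thm. 6, Boolean hardness ⇒ no `VP⁰`-natural proofs against `{per = 0}`) has NO arrow
  here: its VP-version («`P^{#P} ⊄ MA` ⇒ Question 6») would be a new conjecture-grade item, which a
  chain file must not introduce.

WHAT THIS IS NOT: not a proof of any rung; not evidence for `VP ≠ VNP` (the summit is open and every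
hypothesis below is open); the Literature statement files of the seven sources are typed separately
by the cell's typers and are not imported here.

References: [ForbesShpilkaVolk2018] Def. 7, Lemmas 13–14, Cor. 15, Question 6, §8;
[GrochowKumarSaksSaraf2017] Thm. 1, Open Question 1; [ChatterjeeKumarRamyaSaptharishiTengse2020]
Thm. 1.1; [KumarRamyaSaptharishiTengse2022] Thm. MainThm, §5 open problem 1;
[EfremenkoGargOliveiraWigderson2018] Thm. 1.1; [AndrewsForbes2022] Thm. 3.8.
-/

-- layout Summits/ValiantsHypothesis/ValiantsHypothesis forces the duplicated namespace component
set_option linter.dupNamespace false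

noncomputable section

namespace Summit.ValiantsHypothesis.ValiantsHypothesis.Theorems.BarrierLever.NPCorpusChain

open Literature.Barriers.ValiantsHypothesis Literature.Computability.AlgebraicComplexity MvPolynomial
open Summit.ValiantsHypothesis.ValiantsHypothesis.Theorems.BarrierLever.SuccinctHittingSetsForVP
open Summit.ValiantsHypothesis.ValiantsHypothesis.Theses

/-! ### N1 — FSV18: succinct generators suffice -/

/-- **N1 (FSV18 Def. 7 / Cor. 15 ⇒ Question 6).** Succinct hitting-set GENERATORS for `VP` over `ℂ`
(the open Literature hypothesis `SuccinctGeneratorsForVP ℂ`) give the crux (FSV Lemma 14, tree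
`succinctHittingSetsForVP_of_generators`). [cite: ForbesShpilkaVolk2018, Lemma 14 and Cor. 15] -/
theorem crux_of_succinctGeneratorsForVP (h : SuccinctGeneratorsForVP ℂ) :
    BarrierLever.SuccinctHittingSetsForVP :=
  succinctHittingSetsForVP_of_generators h

/-! ### N2 — GKSS17 Open Question 1 (`VP_ws` half) / FSV §1.3: the VBP door -/

/-- **N2 (AD-type door).** Item stmt-ValiantsHypothesis-18966 `SuccinctHittingSetsForVBP`
(VBP-succinct hitting sets against the poly(N) distinguishers, every level) gives the crux: a
`VBP_{n,b}` class is inside `VP_{n,7b+11}` (tree `ADDoor.succinctHittingSetsForVP_of_forVBP`).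
[cite: ForbesShpilkaVolk2018, §1.3] [cite: GrochowKumarSaksSaraf2017, Open Question 1] -/
theorem crux_of_succinctHittingSetsForVBP (h : BarrierLever.SuccinctHittingSetsForVBP) :
    BarrierLever.SuccinctHittingSetsForVP :=
  ADDoor.succinctHittingSetsForVP_of_forVBP h

/-! ### N3 — CKRST20 / KRST22: the VP-version of "equations for a slice" is item 18972 -/

/-- **N3 (win–win, one direction).** Under exponential hardness of the permanent
(`PermanentExpHardWith ℂ c m₀`: `2^j ≤ L(per_{j^c})` for `j ≥ m₀`), if the crux FAILS then level-one
natural proofs separate some `VNP_{·,b₁}` from every `VP_{·,b}` infinitely often — item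
stmt-ValiantsHypothesis-18972 `NaturalProofsSeparateVNP` (tree `WinWin.separate_of_not_succinctHittingSetsForVP`
fed by the tree's unconditional KRST theorem `succinctHittingSetsFromVNP_of_permanentExpHard`).
[cite: KumarRamyaSaptharishiTengse2022, §1.2 and Thm. MainThm] [cite: ChatterjeeKumarRamyaSaptharishiTengse2020, Thm. 1.1] -/
theorem naturalProofsSeparateVNP_of_not_crux {c m₀ : ℕ} (hper : PermanentExpHardWith ℂ c m₀)
    (hQ : ¬ BarrierLever.SuccinctHittingSetsForVP) : BarrierLever.NaturalProofsSeparateVNP := by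
  obtain ⟨b₁, hb₁⟩ := succinctHittingSetsFromVNP_of_permanentExpHard (F := ℂ) hper
  exact ⟨b₁, WinWin.separate_of_not_succinctHittingSetsForVP hb₁ hQ⟩

/-- **N3 (the other direction, unconditional).** Item 18972 refutes the crux
(tree `WinWin.not_succinctHittingSetsForVP_of_separate`). [cite: ForbesShpilkaVolk2018, Question 6] -/
theorem not_crux_of_naturalProofsSeparateVNP (h : BarrierLever.NaturalProofsSeparateVNP) :
    ¬ BarrierLever.SuccinctHittingSetsForVP := by
  obtain ⟨b₁, hb₁⟩ := h
  exact WinWin.not_succinctHittingSetsForVP_of_separate hb₁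

/-! ### N4 — KRST22 open problem 1 = item 18967 `KRSTForVP` -/

/-- **N4 (trivial arrow).** The crux gives item stmt-ValiantsHypothesis-18967 `KRSTForVP` (whose
hardness hypothesis is then unused). [cite: KumarRamyaSaptharishiTengse2022, §5 open problem 1] -/
theorem krstForVP_of_crux (h : BarrierLever.SuccinctHittingSetsForVP) : BarrierLever.KRSTForVP :=
  fun _ => h

/-- **N4 (the failing arrow ★★ is exactly what is needed).** If exponential hardness of the
permanent (in the almost-everywhere subsequence form of `KRSTForVP`'s hypothesis) yields, for all
large `n`, a JOINTLY `VP`-succinct generator (one circuit `Γ(x, y)` of size `≤ n^b` whose seed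
specialisations have degree `≤ n` and coefficient vectors `G(y)`) fooling the level-one
distinguishers, then item 18967 holds — and conversely (tree `WinWin.generator_iff_krstForVP`, an
`Iff`; this is its forward direction at `H :=` the hardness hypothesis).
[cite: KumarRamyaSaptharishiTengse2022, §4] [cite: ForbesShpilkaVolk2018, Lemma 13] -/
theorem krstForVP_of_jointlySuccinctGenerator
    (h : (∃ c m₀ : ℕ, ∀ j : ℕ, m₀ ≤ j → 2 ^ j ≤ complexity (perPoly (Fin (j ^ c)) ℂ)) →
      ∃ b n₀ : ℕ, ∀ n : ℕ, n₀ ≤ n → ∃ (q : ℕ) (G : degLEMonomials n → MvPolynomial (Fin q) ℂ),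
        (∃ Γ : MvPolynomial (Fin n ⊕ Fin q) ℂ, complexity Γ ≤ n ^ b ∧
          ∀ a : Fin q → ℂ, (aeval (Sum.elim X fun j => C (a j)) Γ).totalDegree ≤ n ∧
            ∀ m : degLEMonomials n,
              coeff (m : Fin n →₀ ℕ) (aeval (Sum.elim X fun j => C (a j)) Γ) = eval a (G m)) ∧
        ∀ D ∈ Distinguishers ℂ n 1, D ≠ 0 → bind₁ G D ≠ 0) :
    BarrierLever.KRSTForVP :=
  (WinWin.generator_iff_krstForVP _).mp h

/-- **N4 (KRST's door with its unproven input displayed).** Exponential hardness of the permanent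
AND the succinctness hypothesis `KRSTDoor.KRSTSuccinctInVP ℂ c b` ("KRST's generator on `per` is
eventually `SmallCircuits ℂ n b`-succinct"; open only in the residual band `b ≥ 6c`, items
19049/19050 — the bands below are closed no-go: `BarrierLever.KRSTNoGoBelow6c_holds`) give the
crux (tree `KRSTDoor.succinctHittingSetsForVP_of_permanentExpHard`).
[cite: KumarRamyaSaptharishiTengse2022, Thm. MainThm and §4] -/
theorem crux_of_permanentExpHard_of_krstSuccinctInVP {c m₀ b : ℕ}
    (hper : PermanentExpHardWith ℂ c m₀) (hsucc : KRSTDoor.KRSTSuccinctInVP ℂ c b) :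
    BarrierLever.SuccinctHittingSetsForVP :=
  KRSTDoor.succinctHittingSetsForVP_of_permanentExpHard hper hsucc

/-! ### N5 / N7 — EGOW18 rank-method distinguishers, AF22 determinantal equations, FSV §8:
read-once determinants -/

/-- **N5/N7 (ladder arrow).** The crux gives item stmt-ValiantsHypothesis-20152
`ReadOnceDeterminantsHitByVP` (tree `ReadOnceDeterminantsHitByVP.readOnceDeterminantsHitByVP_of_crux`;
conclusion = the route decl). [cite: ForbesShpilkaVolk2018, Question 6 and §8] -/
theorem readOnceDeterminantsHitByVP_of_crux' (h : BarrierLever.SuccinctHittingSetsForVP) :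
    BarrierLever.ReadOnceDeterminantsHitByVP :=
  ReadOnceDeterminantsHitByVP.readOnceDeterminantsHitByVP_of_crux h

/-- **N5/N7 (what remains of item 20152).** It suffices to hit the torus-BALANCED read-once layouts
(`¬ TorusIsolation.InlineIsolated E`): the torus-isolated ones are hit unconditionally (tree
`TorusIsolation.item20152_iff_balanced`, whose left side is the item's signature).
[cite: ForbesShpilkaVolk2018, §8] [cite: EfremenkoGargOliveiraWigderson2018, Thm. 1.1] -/
theorem readOnceDeterminantsHitByVP_of_balanced
    (h : ∀ a : ℕ, ∃ b n₀ : ℕ, ∀ n : ℕ, n₀ ≤ n →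
      IsSuccinctHittingSet (degLEMonomials n) (SmallCircuits ℂ n b)
      {D | ∃ (r : ℕ) (E : Matrix (Fin r) (Fin r) (↥(degLEMonomials n) ⊕ ℂ)),
      r ≤ (Nat.choose (2 * n) n) ^ a ∧
      (∀ p q : Fin r × Fin r, ∀ m, E p.1 p.2 = Sum.inl m → E q.1 q.2 = Sum.inl m → p = q) ∧
      ¬ TorusIsolation.InlineIsolated E ∧
      D = (E.map (Sum.elim MvPolynomial.X MvPolynomial.C)).det}) :
    BarrierLever.ReadOnceDeterminantsHitByVP :=
  TorusIsolation.item20152_iff_balanced.mpr h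

/-- **N5/N7 (what remains of item 20239).** For the affine-Chow sharpening
`ChowHitsReadOnceDeterminants` (stmt-ValiantsHypothesis-20239) it likewise suffices to treat the
torus-BALANCED constant-free layouts (`¬ TorusIsolation.BetaIsolated β`; tree
`TorusIsolation.item20239_iff_balanced`). [cite: ForbesShpilkaVolk2018, §8] [cite: AndrewsForbes2022, Thm. 3.8] -/
theorem chowHitsReadOnceDeterminants_of_balanced
    (h : ∃ n₀ : ℕ, ∀ n : ℕ, n₀ ≤ n → ∀ (r : ℕ) (β : Fin r × Fin r → ↥(degLEMonomials n)),
      Function.Injective β → ¬ TorusIsolation.BetaIsolated β →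
      ∃ ℓ : Fin n → MvPolynomial (Fin n) ℂ, (∀ i, (ℓ i).totalDegree ≤ 1) ∧
      (Matrix.of fun i j : Fin r =>
      MvPolynomial.coeff ((β (i, j) : ↥(degLEMonomials n)) : Fin n →₀ ℕ) (∏ k, ℓ k)).det ≠ 0) :
    BarrierLever.ChowHitsReadOnceDeterminants :=
  TorusIsolation.item20239_iff_balanced.mpr h

end Summit.ValiantsHypothesis.ValiantsHypothesis.Theorems.BarrierLever.NPCorpusChain

end
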